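import Mathlib
import Summits.Parity.GeneralizedHardyLittlewood.Theses.LiouvilleMAD

/-!
# Sketch (ideator 3, crux-ideate round 1) — crux `CosetDecorrelation` (stmt-Parity-13317)

First-lemma signatures for the idea card `farey-level-mean-coupling` and the calibration /
tightness / dead-variant statements recorded in `IdeatorMemo3.md`.  Everything here is a
`def … : Prop` over existing declarations (plus small concrete `def`s); nothing is claimed proved
except the two `example`s at the end (pure unfolding / logic).

Notation (informal): `u_{n,c}(m) = λ(mn+c)`, `A_{n,c}(M,j,a) = Σ_{m∈(M,2M], m≡a (j)} u(m)`,
`T_j^{(r)}(n,n') = Σ_{(m,m')∈(M,2M]², m ≡ m'+r (j)} u_{n,c}(m) u_{n',c}(m')`; the crux is about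
`T_j^{(0)}`.
-/

namespace Summit.Parity.GeneralizedHardyLittlewood.Cruxes.CosetDecorrelation.Ideator3

open Summit.Parity.GeneralizedHardyLittlewood.Theses.LiouvilleMAD
open Finset

/-- The progression sequence `u_{n,c}(m) = λ(mn+c)` (real-valued, junk `λ 0 = 0` below `mn+c ≤ 0`). -/
noncomputable def u (n : ℕ) (c : ℤ) (m : ℕ) : ℝ :=
  (ArithmeticFunction.liouville (Int.toNat ((m : ℤ) * n + c)) : ℝ)

/-- Class sum `A_{n,c}(M,j,a) = Σ_{m ∈ (M,2M], m ≡ a (mod j)} λ(mn+c)`. -/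
noncomputable def classSum (n : ℕ) (c : ℤ) (M j a : ℕ) : ℝ :=
  ∑ m ∈ (Ioc M (2 * M)).filter (fun m => m ≡ a [MOD j]), u n c m

/-- Offset coset sum `T_j^{(r)} = Σ_{m ≡ m' + r (mod j)} λ(mn+c) λ(m'n'+c)`; `r = 0` is the crux's sum. -/
noncomputable def offsetCoset (n n' : ℕ) (c : ℤ) (M j r : ℕ) : ℝ :=
  ∑ p ∈ (Ioc M (2 * M) ×ˢ Ioc M (2 * M)).filter (fun p : ℕ × ℕ => p.1 ≡ p.2 + r [MOD j]),
    u n c p.1 * u n' c p.2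

/-- The crux's literal left-hand side, as a function of the parameters. -/
noncomputable def cosetSum (n n' : ℕ) (c : ℤ) (M j : ℕ) : ℝ :=
  ∑ p ∈ (Ioc M (2 * M) ×ˢ Ioc M (2 * M)).filter (fun p : ℕ × ℕ => p.1 ≡ p.2 [MOD j]),
    (ArithmeticFunction.liouville (Int.toNat ((p.1 : ℤ) * n + c)) : ℝ) *
      (ArithmeticFunction.liouville (Int.toNat ((p.2 : ℤ) * n' + c)) : ℝ)

/-- Read-back: the crux is the uniform bound on `cosetSum`. -/
theorem cosetDecorrelation_iff :
    CosetDecorrelation ↔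
      ∀ c : ℤ, c ≠ 0 → ∃ ϑ : ℝ, ϑ < 1 / 4 ∧ ∃ C : ℝ, ∀ M n n' j : ℕ, 1 ≤ n → 1 ≤ n' → n ≠ n' →
        n ≤ 2 * M → n' ≤ 2 * M → Nat.sqrt M + 1 ≤ j → j < 2 * (Nat.sqrt M + 1) →
          |cosetSum n n' c M j| ≤ C * (M : ℝ) ^ (3 / 4 + ϑ) :=
  Iff.rfl

/-! ## (1) Normal form, first lemmas (provable now, sizes S/M) -/

/-- FIRST LEMMA (S): the coset sum is the inner product over `ℤ/j` of the two class-sum profiles,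
`T_j = Σ_{a<j} A_n(a) A_{n'}(a)` (fibre the pair set by the common class). -/
def CosetAsClassInnerProduct : Prop :=
  ∀ (n n' : ℕ) (c : ℤ) (M j : ℕ), 1 ≤ j →
    cosetSum n n' c M j = ∑ a ∈ range j, classSum n c M j a * classSum n' c M j a

/-- `CosetAsClassInnerProduct` holds (kernel-checked first lemma: fibre the pair set by `p.1 % j`). -/
theorem cosetAsClassInnerProduct_holds : CosetAsClassInnerProduct := by
  intro n n' c M j hj
  unfold cosetSum classSum
  have key : ∀ a ∈ range j,
      ((Ioc M (2 * M)).filter (fun m => m ≡ a [MOD j])) ×ˢ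
          ((Ioc M (2 * M)).filter (fun m => m ≡ a [MOD j]))
        = (((Ioc M (2 * M) ×ˢ Ioc M (2 * M)).filter (fun p : ℕ × ℕ => p.1 ≡ p.2 [MOD j])).filter
            (fun p : ℕ × ℕ => p.1 % j = a)) := by
    intro a ha
    have ha' : a % j = a := Nat.mod_eq_of_lt (mem_range.mp ha)
    ext ⟨m, m'⟩
    simp only [mem_product, mem_filter, Nat.ModEq]
    constructor
    · rintro ⟨⟨hm, hma⟩, ⟨hm', hm'a⟩⟩
      refine ⟨⟨⟨hm, hm'⟩, ?_⟩, ?_⟩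
      · rw [hma, hm'a]
      · rw [hma, ha']
    · rintro ⟨⟨⟨hm, hm'⟩, hmm'⟩, hma⟩
      refine ⟨⟨hm, ?_⟩, ⟨hm', ?_⟩⟩
      · rw [hma, ha']
      · rw [← hmm', hma, ha']
  symm
  calc ∑ a ∈ range j, (∑ m ∈ (Ioc M (2 * M)).filter (fun m => m ≡ a [MOD j]), u n c m) *
          (∑ m ∈ (Ioc M (2 * M)).filter (fun m => m ≡ a [MOD j]), u n' c m)
      = ∑ a ∈ range j, ∑ p ∈ ((Ioc M (2 * M)).filter (fun m => m ≡ a [MOD j])) ×ˢ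
            ((Ioc M (2 * M)).filter (fun m => m ≡ a [MOD j])), u n c p.1 * u n' c p.2 := by
          refine sum_congr rfl fun a _ => ?_
          rw [sum_mul_sum, ← sum_product']
    _ = ∑ a ∈ range j, ∑ p ∈ (((Ioc M (2 * M) ×ˢ Ioc M (2 * M)).filter
            (fun p : ℕ × ℕ => p.1 ≡ p.2 [MOD j])).filter (fun p : ℕ × ℕ => p.1 % j = a)),
            u n c p.1 * u n' c p.2 := by
          refine sum_congr rfl fun a ha => ?_
          rw [key a ha]
    _ = _ := by
          rw [sum_fiberwise_of_maps_to (fun p _ => mem_range.mpr (Nat.mod_lt _ hj))]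
          rfl

/-- Exponential sum `G_{n,c}(b/j) = Σ_{m∈(M,2M]} λ(mn+c) e(bm/j)`. -/
noncomputable def G (n : ℕ) (c : ℤ) (M j : ℕ) (b : ℕ) : ℂ :=
  ∑ m ∈ Ioc M (2 * M), (u n c m : ℂ) * Complex.exp (2 * Real.pi * Complex.I * ((b : ℂ) * m / j))

/-- FIRST LEMMA (M): Parseval / level form `j · T_j = Σ_{b mod j} G_n(b/j) · conj G_{n'}(b/j)`;
grouping `b` by `d = j / gcd(b,j)` gives the exact Farey-level (Ramanujan) decomposition
`T_j = Σ_{d ∣ j} T_j[d]` with `T_j[1] = (Σ_m λ(mn+c))(Σ_{m'} λ(m'n'+c))/j`. -/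
def CosetParseval : Prop :=
  ∀ (n n' : ℕ) (c : ℤ) (M j : ℕ), 1 ≤ j →
    ((j : ℂ) * (cosetSum n n' c M j : ℂ)) =
      ∑ b ∈ range j, G n c M j b * (starRingEnd ℂ) (G n' c M j b)

/-- The level-1 (mean-coupling) part of `T_j`: product of the two progression means over `j`. -/
noncomputable def levelOne (n n' : ℕ) (c : ℤ) (M j : ℕ) : ℝ :=
  (∑ m ∈ Ioc M (2 * M), u n c m) * (∑ m ∈ Ioc M (2 * M), u n' c m) / j

/-- MEAN-COUPLING IDENTITY (S): `T_j − T_j[1] = Σ_a (A_n(a) − Ā_n)(A_{n'}(a) − Ā_{n'})` with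
`Ā = (1/j) Σ_a A(a) = (1/j) Σ_m u(m)`. -/
def MeanCoupling : Prop :=
  ∀ (n n' : ℕ) (c : ℤ) (M j : ℕ), 1 ≤ j →
    cosetSum n n' c M j - levelOne n n' c M j =
      ∑ a ∈ range j,
        (classSum n c M j a - (∑ m ∈ Ioc M (2 * M), u n c m) / j) *
          (classSum n' c M j a - (∑ m ∈ Ioc M (2 * M), u n' c m) / j)

/-- The classes `a < j` partition `(M,2M]`: `Σ_{a<j} A_n(a) = Σ_m u_n(m)`. -/
theorem sum_classSum (n : ℕ) (c : ℤ) (M j : ℕ) (hj : 1 ≤ j) :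
    ∑ a ∈ range j, classSum n c M j a = ∑ m ∈ Ioc M (2 * M), u n c m := by
  unfold classSum
  have hfilt : ∀ a ∈ range j, (Ioc M (2 * M)).filter (fun m => m ≡ a [MOD j]) =
      (Ioc M (2 * M)).filter (fun m => m % j = a) := by
    intro a ha
    have ha' : a % j = a := Nat.mod_eq_of_lt (mem_range.mp ha)
    ext m
    simp only [mem_filter, Nat.ModEq, ha']
  rw [sum_congr rfl fun a ha => by rw [hfilt a ha]]
  exact sum_fiberwise_of_maps_to (fun m _ => mem_range.mpr (Nat.mod_lt _ hj)) _

/-- `MeanCoupling` holds (kernel-checked): `T_j − T_j[1] = Σ_a (A_n(a) − Ā_n)(A_{n'}(a) − Ā_{n'})`. -/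
theorem meanCoupling_holds : MeanCoupling := by
  intro n n' c M j hj
  rw [cosetAsClassInnerProduct_holds n n' c M j hj]
  unfold levelOne
  have hj' : (j : ℝ) ≠ 0 := by exact_mod_cast (Nat.one_le_iff_ne_zero.mp hj)
  have e : ∀ a : ℕ,
      (classSum n c M j a - (∑ m ∈ Ioc M (2 * M), u n c m) / j) *
          (classSum n' c M j a - (∑ m ∈ Ioc M (2 * M), u n' c m) / j) =
        classSum n c M j a * classSum n' c M j a
          - ((∑ m ∈ Ioc M (2 * M), u n' c m) / j) * classSum n c M j a
          - ((∑ m ∈ Ioc M (2 * M), u n c m) / j) * classSum n' c M j a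
          + ((∑ m ∈ Ioc M (2 * M), u n c m) / j) * ((∑ m ∈ Ioc M (2 * M), u n' c m) / j) := by
    intro a; ring
  simp_rw [e]
  rw [sum_add_distrib, sum_sub_distrib, sum_sub_distrib, ← mul_sum, ← mul_sum,
    sum_classSum n c M j hj, sum_classSum n' c M j hj, sum_const, card_range, nsmul_eq_mul]
  field_simp
  ring

/-! ## (2) What the crux CONTAINS — calibration by the positivity amplifier (provable now, size M) -/

/-- POSITIVITY AMPLIFIER (kernel-checked core of the calibration): for any family of profiles
`A n : ℕ → ℝ` on `ℤ/j` and any finite set of dilations `𝒩`,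
`(Σ_{n∈𝒩} Σ_{a<j} A n a)² ≤ j · Σ_{n,n'∈𝒩} Σ_{a<j} A n a · A n' a`
(the Gram sum is `Σ_a (Σ_n A n a)² ≥ (1/j)(Σ_a Σ_n A n a)²` by Cauchy–Schwarz). Applied with
`A n = classSum n c M j` and `sum_classSum`, the left side is `(Σ_{n∈𝒩} Σ_{m∈(M,2M]} λ(mn+c))²`
and the right side is `j · Σ_{n,n'∈𝒩} T_j(n,n')` (by `cosetAsClassInnerProduct_holds`). -/
theorem amplifier (A : ℕ → ℕ → ℝ) (𝒩 : Finset ℕ) (j : ℕ) :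
    (∑ n ∈ 𝒩, ∑ a ∈ range j, A n a) ^ 2 ≤
      (j : ℝ) * ∑ n ∈ 𝒩, ∑ n' ∈ 𝒩, ∑ a ∈ range j, A n a * A n' a := by
  have h1 : ∑ n ∈ 𝒩, ∑ n' ∈ 𝒩, ∑ a ∈ range j, A n a * A n' a =
      ∑ a ∈ range j, (∑ n ∈ 𝒩, A n a) ^ 2 := by
    symm
    calc ∑ a ∈ range j, (∑ n ∈ 𝒩, A n a) ^ 2
        = ∑ a ∈ range j, ∑ n ∈ 𝒩, ∑ n' ∈ 𝒩, A n a * A n' a := by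
          refine sum_congr rfl fun a _ => ?_
          rw [sq, sum_mul_sum]
      _ = ∑ n ∈ 𝒩, ∑ a ∈ range j, ∑ n' ∈ 𝒩, A n a * A n' a := sum_comm
      _ = ∑ n ∈ 𝒩, ∑ n' ∈ 𝒩, ∑ a ∈ range j, A n a * A n' a := by
          refine sum_congr rfl fun n _ => ?_
          exact sum_comm
  have h2 : ∑ n ∈ 𝒩, ∑ a ∈ range j, A n a = ∑ a ∈ range j, 1 * ∑ n ∈ 𝒩, A n a := by
    rw [sum_comm]
    simp
  rw [h1, h2]
  calc (∑ a ∈ range j, 1 * ∑ n ∈ 𝒩, A n a) ^ 2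
      ≤ (∑ a ∈ range j, (1 : ℝ) ^ 2) * ∑ a ∈ range j, (∑ n ∈ 𝒩, A n a) ^ 2 :=
        sum_mul_sq_le_sq_mul_sq _ _ _
    _ = (j : ℝ) * ∑ a ∈ range j, (∑ n ∈ 𝒩, A n a) ^ 2 := by simp

/-- The amplifier specialised to the crux's objects:
`(Σ_{n∈𝒩} Σ_{m∈(M,2M]} λ(mn+c))² ≤ j · Σ_{n,n'∈𝒩} T_j(n,n')`. -/
theorem tableSum_sq_le_gram (c : ℤ) (M j : ℕ) (hj : 1 ≤ j) (𝒩 : Finset ℕ) :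
    (∑ n ∈ 𝒩, ∑ m ∈ Ioc M (2 * M), u n c m) ^ 2 ≤
      (j : ℝ) * ∑ n ∈ 𝒩, ∑ n' ∈ 𝒩, cosetSum n n' c M j := by
  have := amplifier (fun n a => classSum n c M j a) 𝒩 j
  simp only [sum_classSum _ c M j hj] at this
  refine this.trans (le_of_eq ?_)
  congr 1
  refine sum_congr rfl fun n _ => sum_congr rfl fun n' _ => ?_
  rw [cosetAsClassInnerProduct_holds n n' c M j hj]

/-- TABLE-MEAN BOUND: a power saving `M^{-1/4-κ/2}` for `λ` summed over the shifted multiplication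
table `{mn + c : m ∈ (M,2M], n ≤ N}` (with multiplicity), once `N ≥ M^{1/2+κ}`. -/
def TableMeanBound : Prop :=
  ∀ c : ℤ, c ≠ 0 → ∃ κ : ℝ, 0 < κ ∧ ∃ C : ℝ, ∀ M N : ℕ, N ≤ 2 * M →
    |∑ n ∈ Icc 1 N, ∑ m ∈ Ioc M (2 * M), u n c m| ≤
      C * ((M : ℝ) * Real.sqrt N + (N : ℝ) * (M : ℝ) ^ (3 / 4 - κ / 2))

/-- CALIBRATION (first lemma of the card, provable now): `Σ_{n,n'≤N} T_j(n,n') = ‖Σ_n A_n‖² ≥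
(1/j)(Σ_{n≤N} Σ_m λ(mn+c))²`, the diagonal `T_j(n,n) ≤ j(M/j+1)²`, and the crux on the
`N(N-1)` off-diagonal pairs give `TableMeanBound` with `κ = 1/4 − ϑ`. -/
def Calibration : Prop := CosetDecorrelation → TableMeanBound

/-! ### (2b) The calibration in raw (unsimplified) form — KERNEL-CHECKED -/

/-- `|λ(mn+c)| ≤ 1`. -/
theorem abs_u_le_one (n : ℕ) (c : ℤ) (m : ℕ) : |u n c m| ≤ 1 := by
  unfold u
  rcases eq_or_ne (Int.toNat ((m : ℤ) * n + c)) 0 with h | h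
  · rw [h]; simp
  · rw [ArithmeticFunction.liouville_apply h]
    push_cast
    rw [abs_pow, abs_neg, abs_one, one_pow]

/-- For `a < j` the class filter is the fibre of `m ↦ m % j`. -/
theorem filter_modEq_eq (S : Finset ℕ) {j a : ℕ} (ha : a < j) :
    S.filter (fun m => m ≡ a [MOD j]) = S.filter (fun m => m % j = a) := by
  have ha' : a % j = a := Nat.mod_eq_of_lt ha
  ext m
  simp only [mem_filter, Nat.ModEq, ha']

/-- Each class of `(M,2M]` modulo `j ≥ 1` has at most `2M/j + 1` elements (inject by `m ↦ m / j`). -/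
theorem card_class_le (M j a : ℕ) (_hj : 1 ≤ j) :
    (((Ioc M (2 * M)).filter (fun m => m ≡ a [MOD j])).card : ℝ) ≤ 2 * M / j + 1 := by
  have hinj : Set.InjOn (fun m => m / j)
      (((Ioc M (2 * M)).filter (fun m => m ≡ a [MOD j]) : Finset ℕ) : Set ℕ) := by
    intro m hm m' hm' h
    rw [mem_coe, mem_filter] at hm hm'
    have hmod : m % j = m' % j := hm.2.trans hm'.2.symm
    have h' : m / j = m' / j := h
    calc m = j * (m / j) + m % j := (Nat.div_add_mod m j).symm
      _ = j * (m' / j) + m' % j := by rw [h', hmod]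
      _ = m' := Nat.div_add_mod m' j
  have hmaps : Set.MapsTo (fun m => m / j)
      (((Ioc M (2 * M)).filter (fun m => m ≡ a [MOD j]) : Finset ℕ) : Set ℕ)
      ((range (2 * M / j + 1) : Finset ℕ) : Set ℕ) := by
    intro m hm
    rw [mem_coe, mem_filter, mem_Ioc] at hm
    rw [mem_coe, mem_range]
    exact Nat.lt_succ_of_le (Nat.div_le_div_right hm.1.2)
  have hcard := card_le_card_of_injOn (fun m => m / j) hmaps hinj
  rw [card_range] at hcard
  have hdiv : ((2 * M / j : ℕ) : ℝ) ≤ 2 * (M : ℝ) / j := by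
    have := Nat.cast_div_le (m := 2 * M) (n := j) (α := ℝ)
    push_cast at this
    exact this
  calc (((Ioc M (2 * M)).filter (fun m => m ≡ a [MOD j])).card : ℝ)
      ≤ ((2 * M / j + 1 : ℕ) : ℝ) := by exact_mod_cast hcard
    _ = ((2 * M / j : ℕ) : ℝ) + 1 := by push_cast; ring
    _ ≤ 2 * (M : ℝ) / j + 1 := by linarith

/-- `|A_n(a)| ≤ #class`. -/
theorem abs_classSum_le (n : ℕ) (c : ℤ) (M j a : ℕ) :
    |classSum n c M j a| ≤ (((Ioc M (2 * M)).filter (fun m => m ≡ a [MOD j])).card : ℝ) := by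
  unfold classSum
  calc |∑ m ∈ (Ioc M (2 * M)).filter (fun m => m ≡ a [MOD j]), u n c m|
      ≤ ∑ m ∈ (Ioc M (2 * M)).filter (fun m => m ≡ a [MOD j]), |u n c m| := abs_sum_le_sum_abs _ _
    _ ≤ ∑ m ∈ (Ioc M (2 * M)).filter (fun m => m ≡ a [MOD j]), (1 : ℝ) :=
        sum_le_sum fun m _ => abs_u_le_one n c m
    _ = _ := by simp

/-- The classes partition `(M,2M]`: `Σ_{a<j} #class_a = M`. -/
theorem sum_card_class (M j : ℕ) (hj : 1 ≤ j) :
    ∑ a ∈ range j, (((Ioc M (2 * M)).filter (fun m => m ≡ a [MOD j])).card : ℝ) = M := by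
  have h := card_eq_sum_card_fiberwise (f := fun m => m % j) (s := Ioc M (2 * M)) (t := range j)
    (fun m _ => mem_range.mpr (Nat.mod_lt _ hj))
  rw [Nat.card_Ioc] at h
  have h2 : ∑ a ∈ range j, ((Ioc M (2 * M)).filter (fun m => m ≡ a [MOD j])).card =
      ∑ a ∈ range j, ((Ioc M (2 * M)).filter (fun m => m % j = a)).card :=
    sum_congr rfl fun a ha => by rw [filter_modEq_eq _ (mem_range.mp ha)]
  have h3 : (∑ a ∈ range j, ((Ioc M (2 * M)).filter (fun m => m ≡ a [MOD j])).card : ℕ) = M := by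
    rw [h2, ← h]; omega
  exact_mod_cast h3

/-- TRIVIAL BOUND: `|T_j(n,n')| ≤ (2M/j + 1)·M` (via the class inner product). -/
theorem abs_cosetSum_le (n n' : ℕ) (c : ℤ) (M j : ℕ) (hj : 1 ≤ j) :
    |cosetSum n n' c M j| ≤ (2 * (M : ℝ) / j + 1) * M := by
  rw [cosetAsClassInnerProduct_holds n n' c M j hj]
  calc |∑ a ∈ range j, classSum n c M j a * classSum n' c M j a|
      ≤ ∑ a ∈ range j, |classSum n c M j a * classSum n' c M j a| := abs_sum_le_sum_abs _ _
    _ ≤ ∑ a ∈ range j, (2 * (M : ℝ) / j + 1) *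
          (((Ioc M (2 * M)).filter (fun m => m ≡ a [MOD j])).card : ℝ) := by
        refine sum_le_sum fun a _ => ?_
        rw [abs_mul]
        calc |classSum n c M j a| * |classSum n' c M j a|
            ≤ (((Ioc M (2 * M)).filter (fun m => m ≡ a [MOD j])).card : ℝ) *
                (((Ioc M (2 * M)).filter (fun m => m ≡ a [MOD j])).card : ℝ) :=
              mul_le_mul (abs_classSum_le _ _ _ _ _) (abs_classSum_le _ _ _ _ _) (abs_nonneg _)
                (Nat.cast_nonneg _)
          _ ≤ (2 * (M : ℝ) / j + 1) * (((Ioc M (2 * M)).filter (fun m => m ≡ a [MOD j])).card : ℝ) :=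
              mul_le_mul_of_nonneg_right (card_class_le M j a hj) (Nat.cast_nonneg _)
    _ = (2 * (M : ℝ) / j + 1) * M := by rw [← mul_sum, sum_card_class M j hj]

/-- RAW CALIBRATION: with `j = ⌊√M⌋+1`, the squared table sum is at most `j·(N·diag + N²·crux)`.
Dividing out: `|Σ_{n≤N}Σ_m λ(mn+c)| ≤ C'(M√N + N M^{3/4−κ/2})`, `κ = 1/4 − ϑ` (paper algebra, `TableMeanBound`). -/
def CalibrationRaw : Prop :=
  ∀ c : ℤ, c ≠ 0 → ∃ ϑ : ℝ, ϑ < 1 / 4 ∧ ∃ C : ℝ, ∀ M N : ℕ, 1 ≤ M → N ≤ 2 * M →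
    (∑ n ∈ Icc 1 N, ∑ m ∈ Ioc M (2 * M), u n c m) ^ 2 ≤
      ((Nat.sqrt M + 1 : ℕ) : ℝ) *
        ((N : ℝ) * ((2 * (M : ℝ) / ((Nat.sqrt M + 1 : ℕ) : ℝ) + 1) * M) +
          (N : ℝ) ^ 2 * (C * (M : ℝ) ^ (3 / 4 + ϑ)))

/-- KERNEL-CHECKED: the crux implies the raw calibration. -/
theorem calibrationRaw_of_cosetDecorrelation : CosetDecorrelation → CalibrationRaw := by
  intro hC c hc
  obtain ⟨ϑ, hϑ, C, hT⟩ := hC c hc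
  refine ⟨ϑ, hϑ, C, fun M N hM hN => ?_⟩
  set j : ℕ := Nat.sqrt M + 1 with hjdef
  have hj : 1 ≤ j := by omega
  have hj1 : Nat.sqrt M + 1 ≤ j := le_rfl
  have hj2 : j < 2 * (Nat.sqrt M + 1) := by omega
  have hE : 0 ≤ C * (M : ℝ) ^ (3 / 4 + ϑ) :=
    (abs_nonneg _).trans (hT M 1 2 j le_rfl (by norm_num) (by norm_num) (by omega) (by omega) hj1 hj2)
  refine (tableSum_sq_le_gram c M j hj (Icc 1 N)).trans ?_
  refine mul_le_mul_of_nonneg_left ?_ (Nat.cast_nonneg _)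
  set D : ℝ := (2 * (M : ℝ) / j + 1) * M with hDdef
  set E : ℝ := C * (M : ℝ) ^ (3 / 4 + ϑ) with hEdef
  have hterm : ∀ n ∈ Icc 1 N, ∀ n' ∈ Icc 1 N,
      cosetSum n n' c M j ≤ D * (if n = n' then 1 else 0) + E := by
    intro n hn n' hn'
    rw [mem_Icc] at hn hn'
    split_ifs with h
    · rw [mul_one]
      have := (le_abs_self _).trans (abs_cosetSum_le n n' c M j hj)
      linarith
    · rw [mul_zero, zero_add]
      exact (le_abs_self _).trans (hT M n n' j hn.1 hn'.1 h (by omega) (by omega) hj1 hj2)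
  have hinner : ∀ n ∈ Icc 1 N,
      ∑ n' ∈ Icc 1 N, (D * (if n = n' then (1 : ℝ) else 0) + E) = D + (N : ℝ) * E := by
    intro n hn
    rw [sum_add_distrib, ← mul_sum, sum_ite_eq, if_pos hn, sum_const, Nat.card_Icc, nsmul_eq_mul,
      mul_one, Nat.add_sub_cancel]
  calc ∑ n ∈ Icc 1 N, ∑ n' ∈ Icc 1 N, cosetSum n n' c M j
      ≤ ∑ n ∈ Icc 1 N, ∑ n' ∈ Icc 1 N, (D * (if n = n' then (1 : ℝ) else 0) + E) :=
        sum_le_sum fun n hn => sum_le_sum fun n' hn' => hterm n hn n' hn'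
    _ = ∑ n ∈ Icc 1 N, (D + (N : ℝ) * E) := sum_congr rfl hinner
    _ = (N : ℝ) * D + (N : ℝ) ^ 2 * E := by
        rw [sum_const, Nat.card_Icc, nsmul_eq_mul]
        push_cast
        ring

/-! ### (2c) The ℓ¹ (Bombieri–Vinogradov-shaped) calibration — KERNEL-CHECKED
`CosetDecorrelation ⇒ (Σ_{n≤N} |Σ_{m∈(M,2M]} λ(mn+c)|)² ≤ (⌊√M⌋+1)·(N·diag + N²·crux)`, i.e. after paper algebra
`Σ_{n≤N} |Σ_{m∼M} λ(mn+c)| ≤ C'(M√N + N·M^{3/4−κ/2})`: a POWER-saving level-`1/2` Bombieri–Vinogradov statement for `λ`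
with the fixed residue `c` (moduli `n ≤ N ≍ M = x^{1/2}`, `x = 2MN`), by the amplifier with sign weights. -/

/-- Weighted amplifier specialised to the crux's objects. -/
theorem tableSumW_sq_le_gram (c : ℤ) (M j : ℕ) (hj : 1 ≤ j) (𝒩 : Finset ℕ) (w : ℕ → ℝ) :
    (∑ n ∈ 𝒩, w n * ∑ m ∈ Ioc M (2 * M), u n c m) ^ 2 ≤
      (j : ℝ) * ∑ n ∈ 𝒩, ∑ n' ∈ 𝒩, w n * w n' * cosetSum n n' c M j := by
  have h := amplifier (fun n a => w n * classSum n c M j a) 𝒩 j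
  have e1 : ∀ n, ∑ a ∈ range j, w n * classSum n c M j a = w n * ∑ m ∈ Ioc M (2 * M), u n c m := by
    intro n; rw [← mul_sum, sum_classSum n c M j hj]
  have e2 : ∀ n n', ∑ a ∈ range j, (w n * classSum n c M j a) * (w n' * classSum n' c M j a) =
      w n * w n' * cosetSum n n' c M j := by
    intro n n'
    rw [cosetAsClassInnerProduct_holds n n' c M j hj, mul_sum]
    exact sum_congr rfl fun a _ => by ring
  simp only [e1, e2] at h
  exact h

/-- ℓ¹ RAW CALIBRATION. -/
def CalibrationL1Raw : Prop :=
  ∀ c : ℤ, c ≠ 0 → ∃ ϑ : ℝ, ϑ < 1 / 4 ∧ ∃ C : ℝ, ∀ M N : ℕ, 1 ≤ M → N ≤ 2 * M →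
    (∑ n ∈ Icc 1 N, |∑ m ∈ Ioc M (2 * M), u n c m|) ^ 2 ≤
      ((Nat.sqrt M + 1 : ℕ) : ℝ) *
        ((N : ℝ) * ((2 * (M : ℝ) / ((Nat.sqrt M + 1 : ℕ) : ℝ) + 1) * M) +
          (N : ℝ) ^ 2 * (C * (M : ℝ) ^ (3 / 4 + ϑ)))

/-- KERNEL-CHECKED: the crux implies the ℓ¹ raw calibration (sign-weighted amplifier). -/
theorem calibrationL1Raw_of_cosetDecorrelation : CosetDecorrelation → CalibrationL1Raw := by
  intro hC c hc
  obtain ⟨ϑ, hϑ, C, hT⟩ := hC c hc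
  refine ⟨ϑ, hϑ, C, fun M N hM hN => ?_⟩
  set j : ℕ := Nat.sqrt M + 1 with hjdef
  have hj : 1 ≤ j := by omega
  have hj1 : Nat.sqrt M + 1 ≤ j := le_rfl
  have hj2 : j < 2 * (Nat.sqrt M + 1) := by omega
  -- sign weights
  set w : ℕ → ℝ := fun n => if 0 ≤ ∑ m ∈ Ioc M (2 * M), u n c m then 1 else -1 with hwdef
  have hw : ∀ n, w n * ∑ m ∈ Ioc M (2 * M), u n c m = |∑ m ∈ Ioc M (2 * M), u n c m| := by
    intro n
    simp only [hwdef]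
    split_ifs with h
    · rw [one_mul, abs_of_nonneg h]
    · rw [neg_one_mul, abs_of_neg (lt_of_not_ge h)]
  have hwabs : ∀ n, |w n| = 1 := by
    intro n
    simp only [hwdef]
    split_ifs <;> simp
  have hww : ∀ n n' (x : ℝ), w n * w n' * x ≤ |x| := by
    intro n n' x
    calc w n * w n' * x ≤ |w n * w n' * x| := le_abs_self _
      _ = |x| := by rw [abs_mul, abs_mul, hwabs, hwabs, one_mul, one_mul]
  have hE : 0 ≤ C * (M : ℝ) ^ (3 / 4 + ϑ) :=
    (abs_nonneg _).trans (hT M 1 2 j le_rfl (by norm_num) (by norm_num) (by omega) (by omega) hj1 hj2)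
  have hsq : (∑ n ∈ Icc 1 N, |∑ m ∈ Ioc M (2 * M), u n c m|) ^ 2 =
      (∑ n ∈ Icc 1 N, w n * ∑ m ∈ Ioc M (2 * M), u n c m) ^ 2 := by
    rw [sum_congr rfl fun n _ => (hw n).symm]
  rw [hsq]
  refine (tableSumW_sq_le_gram c M j hj (Icc 1 N) w).trans ?_
  refine mul_le_mul_of_nonneg_left ?_ (Nat.cast_nonneg _)
  set D : ℝ := (2 * (M : ℝ) / j + 1) * M with hDdef
  set E : ℝ := C * (M : ℝ) ^ (3 / 4 + ϑ) with hEdef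
  have hterm : ∀ n ∈ Icc 1 N, ∀ n' ∈ Icc 1 N,
      w n * w n' * cosetSum n n' c M j ≤ D * (if n = n' then 1 else 0) + E := by
    intro n hn n' hn'
    rw [mem_Icc] at hn hn'
    refine (hww n n' _).trans ?_
    split_ifs with h
    · rw [mul_one]
      have := abs_cosetSum_le n n' c M j hj
      linarith
    · rw [mul_zero, zero_add]
      exact hT M n n' j hn.1 hn'.1 h (by omega) (by omega) hj1 hj2
  have hinner : ∀ n ∈ Icc 1 N,
      ∑ n' ∈ Icc 1 N, (D * (if n = n' then (1 : ℝ) else 0) + E) = D + (N : ℝ) * E := by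
    intro n hn
    rw [sum_add_distrib, ← mul_sum, sum_ite_eq, if_pos hn, sum_const, Nat.card_Icc, nsmul_eq_mul,
      mul_one, Nat.add_sub_cancel]
  calc ∑ n ∈ Icc 1 N, ∑ n' ∈ Icc 1 N, w n * w n' * cosetSum n n' c M j
      ≤ ∑ n ∈ Icc 1 N, ∑ n' ∈ Icc 1 N, (D * (if n = n' then (1 : ℝ) else 0) + E) :=
        sum_le_sum fun n hn => sum_le_sum fun n' hn' => hterm n hn n' hn'
    _ = ∑ n ∈ Icc 1 N, (D + (N : ℝ) * E) := sum_congr rfl hinner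
    _ = (N : ℝ) * D + (N : ℝ) ^ 2 * E := by
        rw [sum_const, Nat.card_Icc, nsmul_eq_mul]
        push_cast
        ring

/-! ## (3) Tightness of the exponent 3/4 (Welch bound; for the disprover) -/

/-- Variance of the class-sum profile, `V_n = Σ_a A_n(a)² = T_j(n,n)`. -/
noncomputable def classVariance (n : ℕ) (c : ℤ) (M j : ℕ) : ℝ :=
  ∑ a ∈ range j, classSum n c M j a ^ 2

/-- WELCH FLOOR: if every row variance is at least `M/2` (the random-model diagonal), some
off-diagonal coset sum is `≥ M^{3/4}/4`: `2M+…` vectors in `ℝ^j`, `j < 2√M+2`, cannot be more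
incoherent (Welch: `Σ_{n,n'} ⟨A_n,A_{n'}⟩² ≥ (Σ_n ‖A_n‖²)²/j`). So `ϑ < 0` is impossible
whenever `V_n ≍ M`. -/
def WelchFloor : Prop :=
  ∃ M₀ : ℕ, ∀ (c : ℤ) (M j : ℕ), M₀ ≤ M → Nat.sqrt M + 1 ≤ j → j < 2 * (Nat.sqrt M + 1) →
    (∀ n ∈ Icc 1 (2 * M), (M : ℝ) / 2 ≤ classVariance n c M j) →
    (∀ n ∈ Icc 1 (2 * M), classVariance n c M j ≤ 2 * M) →
      ∃ n ∈ Icc 1 (2 * M), ∃ n' ∈ Icc 1 (2 * M), n ≠ n' ∧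
        (M : ℝ) ^ (3 / 4 : ℝ) / 4 ≤ |cosetSum n n' c M j|

/-! ## (4) Dead variant recorded for the memo: moment method over coset offsets -/

/-- OFFSET FOURTH MOMENT `Σ_{r mod j} (T_j^{(r)})⁴ ≤ C M^{3+4ϑ}`: trivially implies the crux with the
same `ϑ` (drop `r ≠ 0`); first moment level with slack (`Σ_r (T^{(r)})² = ‖G_nG_{n'}‖²/j ≈ M²` is
pinned by Parseval; the random fourth moment is `≈ 3M^{7/2}`, the budget `M^{3+4ϑ}`, so
`ϑ > 1/8` is forced for THIS route).  NOT filed as a card: Hölder-decoupling of the two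
progressions loses `M^{3/4}` against a room of `M^{1/2−4κ}` (IdeatorMemo3 §F6c). -/
def OffsetFourthMoment : Prop :=
  ∀ c : ℤ, c ≠ 0 → ∃ ϑ : ℝ, ϑ < 1 / 4 ∧ ∃ C : ℝ, ∀ M n n' j : ℕ, 1 ≤ n → 1 ≤ n' → n ≠ n' →
    n ≤ 2 * M → n' ≤ 2 * M → Nat.sqrt M + 1 ≤ j → j < 2 * (Nat.sqrt M + 1) →
      ∑ r ∈ range j, offsetCoset n n' c M j r ^ 4 ≤ C * (M : ℝ) ^ (3 + 4 * ϑ)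

/-- The (trivial) transfer direction. -/
def OffsetFourthMomentTransfer : Prop := OffsetFourthMoment → CosetDecorrelation

/-! ## (5) Residual stub of the line (conjecture-grade, stated for the record) -/

/-- MEAN-CORRECTED COSET DECORRELATION: the crux with its level-1 term removed.  Together with a
one-point power-PNT input `|Σ_{m∈(M,2M]} λ(mn+c)| ≤ C M^{3/4−κ/2}` (all `n ≤ 2M`) it gives the
crux back (MeanCoupling + `|T_j[1]| ≤ M^{2(3/4−κ/2)}/j`).  It is the honest residual: still a
square-root-regime bilinear statement, insensitive to zeros of `ζ` but not of `L(s,χ)`, `cond χ ∣ j`. -/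
def MeanCorrectedCosetDecorrelation : Prop :=
  ∀ c : ℤ, c ≠ 0 → ∃ ϑ : ℝ, ϑ < 1 / 4 ∧ ∃ C : ℝ, ∀ M n n' j : ℕ, 1 ≤ n → 1 ≤ n' → n ≠ n' →
    n ≤ 2 * M → n' ≤ 2 * M → Nat.sqrt M + 1 ≤ j → j < 2 * (Nat.sqrt M + 1) →
      |cosetSum n n' c M j - levelOne n n' c M j| ≤ C * (M : ℝ) ^ (3 / 4 + ϑ)

/-- ONE-POINT POWER PNT along the progressions `c mod n` at exponent `3/4 − κ/2` (what level 1
needs; quasi-GRH(3/4)-grade for `n` bounded, Hooley/Montgomery-grade for `n ≍ M`). -/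
def ProgressionMeanPowerSaving : Prop :=
  ∀ c : ℤ, c ≠ 0 → ∃ κ : ℝ, 0 < κ ∧ ∃ C : ℝ, ∀ M n : ℕ, 1 ≤ n → n ≤ 2 * M →
    |∑ m ∈ Ioc M (2 * M), u n c m| ≤ C * (M : ℝ) ^ (3 / 4 - κ / 2)

/-- Composition of the normal form (pure bookkeeping once `MeanCoupling` is proved):
`MeanCoupling`-identity + `ProgressionMeanPowerSaving` + `MeanCorrectedCosetDecorrelation` ⇒ crux. -/
def NormalFormComposition : Prop :=
  ProgressionMeanPowerSaving → MeanCorrectedCosetDecorrelation → CosetDecorrelation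

-- sanity: the transfer statements are well-typed implications between Props
example : OffsetFourthMomentTransfer = (OffsetFourthMoment → CosetDecorrelation) := rfl
example : Calibration = (CosetDecorrelation → TableMeanBound) := rfl

end Summit.Parity.GeneralizedHardyLittlewood.Cruxes.CosetDecorrelation.Ideator3
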